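import Mathlib
import HarnessLib
import HarnessLib.Audit
import Summits.KontsevichZagierPeriods.Zeta5Search.CatalanTwoAdicRay
import Summits.KontsevichZagierPeriods.Zeta5Search.Denom.CatalanRayPClosedInt

/-!
# Catalan rays — `RayIntegrality j` (j ≥ 4) reduces to the identification node alone

Cell `pub-zeta5`, fam-denom (service lane, gen 4), for fam-catalan's 2-adic ray chain.
HONEST FRAMING: systematic search; no irrationality claim unless certified.  Nothing here concerns the
irrationality of `G`; this file only rewires two hypotheses.

fam-catalan's hypothesis schema `CatalanTwoAdicSeries.RayIntegrality j` says: whenever Viola's symmetric integral on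
the ray, `Jsym n (jn) n ((j+1)n) n`, is `rayQ j n · G + P` with `P : ℚ`, the cleared number `rayMult j n · P` is an
integer (`rayMult j n = d*_{(j+1)n} · d*_{jn} · 2^{2(2j+1)n}`).  fam-denom's `Denom.CatalanRayPClosed.rayPClosed_isInt`
PROVES `d*_{(j+1)n} · d*_{jn} · 2^{2(2j+1)n} · rayPClosed j n ∈ ℤ` for all `j ≥ 4`, `n ≥ 1`, for the EXPLICIT closed
form `rayPClosed`.  Hence `RayIntegrality j` follows from the single ANALYTIC identification
`RayIdentification j : ∀ n ≥ 1, Jsym n (jn) n ((j+1)n) n = rayQ j n · G + rayPClosed j n` — typed below as a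
hypothesis schema (NOT proved anywhere in the tree: it is the series development of the double integral plus the
partial-fraction bookkeeping of CATK1/CATK6 §2).  No irrationality of `G` is used: two rational `P` with the same
real identity are equal by cancellation.

* `RayIdentification j` — the identification node (hypothesis schema, `@[conjecture]`);
* `rayMult_eq` — fam-catalan's multiplier is literally fam-denom's `dstarOdd · dstarOdd · 2^k` (`rfl`);
* `rayIntegrality_of_identification : 4 ≤ j → RayIdentification j → RayIntegrality j`.
-/

namespace Summit.KontsevichZagierPeriods.Zeta5Search.Denom.CatalanRayPClosed

open Literature.NumberTheory.Irrationality.Nesterenko2016 (Jsym)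
open Literature.NumberTheory.Transcendental (catalanConstant)
open Summit.KontsevichZagierPeriods.Zeta5Search.CatalanTwoAdicSeries (rayQ rayMult RayIntegrality)

/-- HYPOTHESIS SCHEMA — the identification node: on the ray `(n, jn, n, (j+1)n, n)` the rational part of Viola's
`Jsym` is fam-denom's explicit closed form `rayPClosed j n` (and the `G`-coefficient is `rayQ j n = catalanQ …`).
NOT proved in the tree (analytic: series development of the double integral + partial fractions). -/
@[conjecture] def RayIdentification (j : ℕ) : Prop :=
  ∀ n : ℕ, 1 ≤ n →
    Jsym n (j * n) n ((j + 1) * n) n = (rayQ j n : ℝ) * catalanConstant + ((rayPClosed j n : ℚ) : ℝ)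

/-- fam-catalan's ray multiplier is fam-denom's `d*_{(j+1)n} · d*_{jn} · 2^{2(2j+1)n}` (the two `dstarOdd` are the
same definition). -/
theorem rayMult_eq (j n : ℕ) :
    rayMult j n = ((dstarOdd ((j + 1) * n) * dstarOdd (j * n) : ℕ) : ℚ) * 2 ^ (2 * (2 * j + 1) * n) := rfl

/-- **`RayIntegrality j` for `j ≥ 4` from the identification node alone** (the arithmetic is the theorem
`rayPClosed_isInt`; uniqueness of the rational part is cancellation in `ℝ`, no irrationality needed). -/
theorem rayIntegrality_of_identification {j : ℕ} (hj : 4 ≤ j) (hId : RayIdentification j) :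
    RayIntegrality j := by
  intro n hn P hP
  have hPeq : P = rayPClosed j n := by
    have h : (rayQ j n : ℝ) * catalanConstant + (P : ℝ)
        = (rayQ j n : ℝ) * catalanConstant + ((rayPClosed j n : ℚ) : ℝ) := hP.symm.trans (hId n hn)
    exact_mod_cast add_left_cancel h
  obtain ⟨z, hz⟩ := rayPClosed_isInt j n hj hn
  exact ⟨z, by rw [hz, hPeq, rayMult_eq]⟩

end Summit.KontsevichZagierPeriods.Zeta5Search.Denom.CatalanRayPClosed
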